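import Summits.KontsevichZagierPeriods.KontsevichZagierPeriods.Theorems.RootDecompQuadraticDescentEulerDissect

/-!
# Euler's reflection `ζ(2) = 2·Li₂(½) + log²2` BY THE MOVES, inside dimension 2 — part 3/4: the `log 2` interval `ell`, the product square `E2 = ell × ell`, MOVE 3 (affine chart onto `P₁ᵒ`) and the ASSEMBLY `eulerReflection_byMoves : of Zsq − 2•of Ltri − of ell * of ell ∈ KZ.relations`, `value_Ltri = π²/12 − log²2/2`

Theorems-split (≤ 400 lines each) of the decomp-kz lens-6 gen-4 file
`run/shared/lean/pub/decomp-kz/decomp-kz-lens-6/g4/RootDecompQuadraticDescentEulerReflection.lean` (1018 lines, critic re-check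
2026-08-30T04:40:16Z: rc0, axioms(eulerReflection_byMoves) = {propext, Classical.choice, Quot.sound}); parts:
`…EulerShear` → `…EulerDissect` → `…EulerReflection` → `…EulerCensus`. Support for item stmt-KontsevichZagierPeriods-26540
(QuadraticDescent) and a decided ≥3-term dimension-2 instance for stmt-KontsevichZagierPeriods-4280.
Sources: Euler 1768; L. Lewin, *Polylogarithms and associated functions* (1981) §1.5; D. Zagier, *The dilogarithm function* (2007)
§I.1–I.2; M. Kontsevich, D. Zagier, *Periods* (2001) §1.1, §1.2 (rules 1a, 1b, 2).
-/

noncomputable section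

set_option linter.dupNamespace false

open MeasureTheory Set
open MvPolynomial (aeval X C)
open Literature.ModelTheory.ExponentialFields (IsSemialgebraic tarski_seidenberg_real_holds)

namespace Summit.KontsevichZagierPeriods.KontsevichZagierPeriods.Theorems.RootDecompQuadraticDescentEulerReflection

open Literature.NumberTheory.Transcendental
open Literature.NumberTheory.Transcendental.KZ

/-! ### The `log 2` interval `ell = [(1,2), dt/t]` and the product square `E2 = ell × ell` -/

/-- Auxiliary step `I12`. [bookkeeping] -/
def I12 : Set (Fin 1 → ℝ) := {t | t 0 ∈ Set.Ioo (1:ℝ) 2}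

/-- `I12` is `ℚ`-semialgebraic. [BCR1998 §2.2] -/
lemma isSemialgebraic_I12 : IsSemialgebraic ℚ I12 := by
  have h := isSemialgebraic_setOf_forall_aeval_pos ![(X 0 - 1 : MvPolynomial (Fin 1) ℚ), C 2 - X 0]
  convert h using 1
  ext t
  simp only [I12, mem_setOf_eq, mem_Ioo, Fin.forall_fin_succ, Matrix.cons_val_zero, Matrix.cons_val_succ,
    map_sub, map_one, MvPolynomial.aeval_X, MvPolynomial.aeval_C, eq_ratCast, sub_pos, IsEmpty.forall_iff,
    and_true]
  norm_num

/-- `I12` is measurable. [bookkeeping] -/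
lemma measurableSet_I12 : MeasurableSet I12 :=
  measurableSet_Ioo.preimage (measurable_pi_apply 0)

/-- Integrability on the relevant piece (`integrableOn_I12_of`). [bookkeeping] -/
lemma integrableOn_I12_of {f : ℝ → ℝ} (hf : IntegrableOn f (Set.Ioo (1:ℝ) 2)) :
    IntegrableOn (fun t : Fin 1 → ℝ => f (t 0)) I12 :=
  ((volume_preserving_funUnique (Fin 1) ℝ).integrableOn_comp_preimage
      (MeasurableEquiv.funUnique (Fin 1) ℝ).measurableEmbedding).2 hf

/-- Set integral over `I12` rewritten in one variable. [bookkeeping] -/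
lemma setIntegral_I12 (f : ℝ → ℝ) :
    ∫ t in I12, f (t 0) = ∫ x in Set.Ioo (1:ℝ) 2, f x :=
  (volume_preserving_funUnique (Fin 1) ℝ).setIntegral_preimage_emb
    (MeasurableEquiv.funUnique (Fin 1) ℝ).measurableEmbedding f (Set.Ioo (1:ℝ) 2)

/-- The integrand of `ell` as a function (polynomial quotient unfolded). [bookkeeping] -/
lemma ell_aux : (fun t : Fin 1 → ℝ => aeval t (1 : MvPolynomial (Fin 1) ℚ) / aeval t (X 0 : MvPolynomial (Fin 1) ℚ)) =
    fun t => (fun x : ℝ => 1 / x) (t 0) := by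
  funext t; simp

/-- Integrability on the relevant piece (`integrableOn_one_div_Ioo`). [bookkeeping] -/
lemma integrableOn_one_div_Ioo : IntegrableOn (fun x : ℝ => 1 / x) (Set.Ioo (1:ℝ) 2) := by
  have hc : ContinuousOn (fun x : ℝ => 1 / x) (Set.Icc (1:ℝ) 2) :=
    continuousOn_const.div continuousOn_id fun x hx => by linarith [hx.1]
  exact (hc.integrableOn_Icc).mono_set Ioo_subset_Icc_self

/-- `ell := [(1,2), dt/t]`, KZ-rational, dimension `1`, value `log 2`. -/
def ell : KZ.IntegralRep 1 :=
  KZ.IntegralRep.ofRational I12 1 (X 0) isSemialgebraic_I12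
    (fun t ht => by have h := ht.1; simp only [MvPolynomial.aeval_X, ne_eq]; linarith)
    (by rw [ell_aux]; exact integrableOn_I12_of integrableOn_one_div_Ioo)

/-- `ell` is KZ-rational. [bookkeeping] -/
lemma isRational_ell : ell.IsRational := KZ.IntegralRep.isRational_ofRational _ _ _ _ _ _
/-- The domain of `ell`, by definition. [bookkeeping] -/
lemma domain_ell : ell.domain = I12 := rfl
/-- The integrand of `ell`, unfolded. [bookkeeping] -/
lemma integrand_ell : ell.integrand = fun t => 1 / t 0 := by
  rw [ell, KZ.IntegralRep.integrand_ofRational, ell_aux]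

/-- Auxiliary step `integral_one_div_Ioo`. [bookkeeping] -/
lemma integral_one_div_Ioo : ∫ x in Set.Ioo (1:ℝ) 2, 1 / x = Real.log 2 := by
  rw [← integral_Ioc_eq_integral_Ioo, ← intervalIntegral.integral_of_le (by norm_num : (1:ℝ) ≤ 2)]
  have h : ∫ x in (1:ℝ)..2, 1 / x = Real.log (2 / 1) :=
    integral_one_div (by norm_num [Set.uIcc_of_le (show (1:ℝ) ≤ 2 by norm_num)])
  rw [h, div_one]

/-- `value ell = log 2`. -/
theorem value_ell : ell.value = Real.log 2 := by
  rw [ell, KZ.IntegralRep.value_ofRational, ell_aux, setIntegral_I12, integral_one_div_Ioo]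

/-- `E2 := ell × ell = [(1,2)², ds dt/(st)]` (a PRODUCT of two `1`-dimensional rationals). -/
def E2 : KZ.IntegralRep 2 := ell.prod ell


/-- Membership in `E2`, unfolded. [bookkeeping] -/
lemma mem_E2 {z : Fin 2 → ℝ} : z ∈ E2.domain ↔ z 0 ∈ Set.Ioo (1:ℝ) 2 ∧ z 1 ∈ Set.Ioo (1:ℝ) 2 := by
  change z ∈ (ell.prod ell).domain ↔ _
  rw [KZ.IntegralRep.prod_domain, KZ.IntegralRep.mem_prodDomain, domain_ell]
  simp only [I12, mem_setOf_eq, show (Fin.castAdd 1 (0 : Fin 1) : Fin 2) = 0 from rfl, show (Fin.natAdd 1 (0 : Fin 1) : Fin 2) = 1 from rfl]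

/-- The integrand of `E2`, unfolded. [bookkeeping] -/
lemma integrand_E2 {z : Fin 2 → ℝ} : E2.integrand z = 1 / z 0 * (1 / z 1) := by
  change (ell.prod ell).integrand z = _
  rw [KZ.IntegralRep.prod_integrand_eq, KZ.IntegralRep.prodFun_apply, integrand_ell]
  simp only [show (Fin.castAdd 1 (0 : Fin 1) : Fin 2) = 0 from rfl, show (Fin.natAdd 1 (0 : Fin 1) : Fin 2) = 1 from rfl]

/-- Auxiliary step `of_ell_mul_of_ell`. [bookkeeping] -/
lemma of_ell_mul_of_ell : of ell * of ell = of E2 := by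
  rw [of_mul_of]; rfl

/-! ### MOVE 3 (rule 2, the affine map `(s,t) ↦ (s/2, 1 − t/2)`): `(1,2)² → P₁ᵒ = (½,1) × (0,½)` -/

/-- The open rectangle `P₁ᵒ = (½,1) × (0,½)` (= `P₁` up to the null segment `x = ½`). -/
def P₁o : Set (Fin 2 → ℝ) := {z | 1 / 2 < z 0 ∧ z 0 < 1 ∧ 0 < z 1 ∧ z 1 < 1 / 2}

/-- `P₁o` is `ℚ`-semialgebraic. [BCR1998 §2.2] -/
lemma isSemialgebraic_P₁o : IsSemialgebraic ℚ P₁o := by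
  have h := isSemialgebraic_setOf_forall_aeval_pos
    ![(X 0 - C (1/2) : MvPolynomial (Fin 2) ℚ), 1 - X 0, X 1, C (1/2) - X 1]
  convert h using 1
  ext z
  simp only [P₁o, mem_setOf_eq, Fin.forall_fin_succ, Matrix.cons_val_zero, Matrix.cons_val_succ, map_sub,
    map_one, MvPolynomial.aeval_X, MvPolynomial.aeval_C, eq_ratCast, sub_pos, IsEmpty.forall_iff, and_true]
  norm_num

/-- `P₁o ⊆ T`. [bookkeeping] -/
lemma P₁o_subset_T : P₁o ⊆ T := fun z ⟨h0, h1, h2, h3⟩ => ⟨h2, by linarith, h1⟩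

/-- Auxiliary step `P₁otri`. [bookkeeping] -/
def P₁otri : KZ.IntegralRep 2 := Ttri.restrict P₁o isSemialgebraic_P₁o P₁o_subset_T

/-- Auxiliary step `exists_affChart`. [bookkeeping] -/
theorem exists_affChart :
    ∃ (A : (Fin 2 → ℝ) → (Fin 2 → ℝ)) (M : (Fin 2 → ℝ) →L[ℝ] (Fin 2 → ℝ)),
      (∀ z, A z 0 = 2⁻¹ * z 0) ∧ (∀ z, A z 1 = 1 - 2⁻¹ * z 1) ∧
      IsSemialgebraicMapOn ℚ E2.domain A ∧ (∀ z, HasFDerivAt A M z) ∧ Set.InjOn A E2.domain ∧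
      A '' E2.domain = P₁o ∧ M.det = -4⁻¹ := by
  set A : (Fin 2 → ℝ) → (Fin 2 → ℝ) := fun z => ![2⁻¹ * z 0, 1 - 2⁻¹ * z 1] with hA
  set M : (Fin 2 → ℝ) →L[ℝ] (Fin 2 → ℝ) :=
    LinearMap.toContinuousLinearMap (Matrix.toLin' !![(2⁻¹ : ℝ), 0; 0, -2⁻¹]) with hM
  have hA0 : ∀ z, A z 0 = 2⁻¹ * z 0 := fun z => rfl
  have hA1 : ∀ z, A z 1 = 1 - 2⁻¹ * z 1 := fun z => rfl
  have hM0 : ∀ v : Fin 2 → ℝ, M v 0 = 2⁻¹ * v 0 := by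
    intro v
    change Matrix.toLin' !![(2⁻¹ : ℝ), 0; 0, -2⁻¹] v 0 = _
    rw [Matrix.toLin'_apply]
    simp [Matrix.mulVec, dotProduct, Fin.sum_univ_two]
  have hM1 : ∀ v : Fin 2 → ℝ, M v 1 = -2⁻¹ * v 1 := by
    intro v
    change Matrix.toLin' !![(2⁻¹ : ℝ), 0; 0, -2⁻¹] v 1 = _
    rw [Matrix.toLin'_apply]
    simp [Matrix.mulVec, dotProduct, Fin.sum_univ_two]
  have hdet : M.det = -4⁻¹ := by
    change LinearMap.det (Matrix.toLin' !![(2⁻¹ : ℝ), 0; 0, -2⁻¹]) = _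
    rw [LinearMap.det_toLin', Matrix.det_fin_two]
    norm_num
  have hderiv : ∀ z, HasFDerivAt A M z := by
    intro z
    have h0 : HasFDerivAt (fun y : Fin 2 → ℝ => y 0)
        (ContinuousLinearMap.proj (R := ℝ) (φ := fun _ : Fin 2 => ℝ) 0) z := hasFDerivAt_apply 0 z
    have h1 : HasFDerivAt (fun y : Fin 2 → ℝ => y 1)
        (ContinuousLinearMap.proj (R := ℝ) (φ := fun _ : Fin 2 => ℝ) 1) z := hasFDerivAt_apply 1 z
    rw [hasFDerivAt_pi']
    refine Fin.forall_fin_two.mpr ⟨?_, ?_⟩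
    · have hf : (fun y : Fin 2 → ℝ => A y 0) = fun y => 2⁻¹ * y 0 := funext fun y => rfl
      rw [hf]
      refine (h0.const_mul 2⁻¹).congr_fderiv (ContinuousLinearMap.ext fun v => ?_)
      simp [hM0]
    · have hf : (fun y : Fin 2 → ℝ => A y 1) = fun y => 1 - 2⁻¹ * y 1 := funext fun y => rfl
      rw [hf]
      refine ((h1.const_mul 2⁻¹).const_sub 1).congr_fderiv (ContinuousLinearMap.ext fun v => ?_)
      simp [hM1]
  refine ⟨A, M, hA0, hA1, ?_, hderiv, ?_, ?_, hdet⟩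
  · convert isSemialgebraicMapOn_aeval E2.isSemialgebraic_domain
      ![(C (1/2) * MvPolynomial.X 0 : MvPolynomial (Fin 2) ℚ), 1 - C (1/2) * MvPolynomial.X 1] using 2 with z
    funext i
    fin_cases i
    · simp [hA0]
    · simp [hA1]
  · intro x _ y _ hxy
    have e0 := congrFun hxy 0
    have e1 := congrFun hxy 1
    simp only [hA0, hA1] at e0 e1
    funext i
    fin_cases i
    · change x 0 = y 0; linarith
    · change x 1 = y 1; linarith
  · ext w
    constructor
    · rintro ⟨z, hz, rfl⟩
      rw [mem_E2] at hz
      obtain ⟨⟨h0, h1⟩, h2, h3⟩ := hz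
      simp only [P₁o, mem_setOf_eq, hA0, hA1]
      exact ⟨by linarith, by linarith, by linarith, by linarith⟩
    · rintro ⟨h0, h1, h2, h3⟩
      refine ⟨![2 * w 0, 2 - 2 * w 1], ?_, ?_⟩
      · rw [mem_E2]
        simp only [Matrix.cons_val_zero, Matrix.cons_val_one, mem_Ioo]
        exact ⟨⟨by linarith, by linarith⟩, by linarith, by linarith⟩
      · funext i
        fin_cases i
        · change 2⁻¹ * (2 * w 0) = w 0; ring
        · change 1 - 2⁻¹ * (2 - 2 * w 1) = w 1; ring

/-- MOVE 3: `[E2] − [P₁otri] ∈ KZ.relations`. -/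
theorem E2_sub_P₁otri_mem : of E2 - of P₁otri ∈ KZ.relations := by
  obtain ⟨A, M, hA0, hA1, hsa, hderiv, hinj, himage, hdet⟩ := exists_affChart
  refine changeOfVariablesRel_subset_relations ⟨2, E2, P₁otri, A, fun _ => M, hsa,
    fun z _ => (hderiv z).hasFDerivWithinAt, hinj, himage.symm, fun z hz => ?_, rfl⟩
  rw [mem_E2] at hz
  obtain ⟨⟨h0, h1⟩, h2, h3⟩ := hz
  change E2.integrand z = Ttri.integrand (A z) * |M.det|
  rw [integrand_E2, integrand_Ttri, hdet]
  have h4 : |(-4⁻¹ : ℝ)| = 4⁻¹ := by norm_num [abs_of_neg]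
  simp only [hA0, hA1, h4]
  have hz0 : z 0 ≠ 0 := by linarith
  have hz1 : z 1 ≠ 0 := by linarith
  have e1 : (1:ℝ) - (1 - 2⁻¹ * z 1) = 2⁻¹ * z 1 := by ring
  rw [e1, one_div_mul_one_div, one_div, one_div, ← mul_inv]
  congr 1
  ring

/-- NULL ADJUSTMENT: `[P₁tri] − [P₁otri] ∈ KZ.relations` (the segment `x = ½` is null). -/
theorem P₁tri_sub_P₁otri_mem : of P₁tri - of P₁otri ∈ KZ.relations := by
  refine KZ.of_sub_of_mem_relations_of_null P₁tri P₁otri ?_ ?_ fun _ _ => rfl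
  · change volume (P₁ \ P₁o) = 0
    refine measure_mono_null (fun z hz => ?_) (BallPeeling.volume_setOf_apply_eq_const 2 0 (1/2))
    have h1 := mem_P₁.mp hz.1
    have h2 : ¬ (1 / 2 < z 0 ∧ z 0 < 1 ∧ 0 < z 1 ∧ z 1 < 1 / 2) := hz.2
    change z 0 = 1 / 2
    by_contra hne
    exact h2 ⟨lt_of_le_of_ne h1.2.2.1 (Ne.symm hne), h1.2.2.2, h1.1, h1.2.1⟩
  · change volume (P₁o \ P₁) = 0
    have : P₁o \ P₁ = ∅ := by
      ext z
      simp only [mem_sdiff, mem_empty_iff_false, iff_false, not_and, not_not]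
      rintro ⟨h0, h1, h2, h3⟩
      exact mem_P₁.mpr ⟨h2, h3, h0.le, h1⟩
    rw [this, measure_empty]

/-! ### Assembly: Euler's reflection by the moves -/

/-- **Euler's reflection formula by the moves, inside dimension `2`.**
`[Zsq] − 2·[Ltri] − [ell]·[ell] ∈ KZ.relations`: one shear (rule 2), two dissections (rule 1a),
one affine involution (rule 2), one affine chart (rule 2), two null adjustments and the product rule —
no Stokes move and no appeal to a value coincidence. Numerically: `ζ(2) = 2·Li₂(½) + log²2`. -/
theorem eulerReflection_byMoves : of Zsq - 2 • of Ltri - of ell * of ell ∈ KZ.relations := by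
  have h1 := Zsq_sub_Ttri_mem
  have h2 := split₁_mem
  have h3 := split₂_mem
  have h4 := P₂tri_sub_Lplustri_mem
  have h5 := Lplustri_sub_Ltri_mem
  have h6 := P₁tri_sub_P₁otri_mem
  have h7 := E2_sub_P₁otri_mem
  rw [of_ell_mul_of_ell]
  have e : of Zsq - 2 • of Ltri - of E2 = (of Zsq - of Ttri) + (of Ttri - of Ltri - of Btri) +
      (of Btri - of P₁tri - of P₂tri) + (of P₂tri - of Lplustri) + (of Lplustri - of Ltri) +
      (of P₁tri - of P₁otri) - (of E2 - of P₁otri) := by abel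
  rw [e]
  exact sub_mem (add_mem (add_mem (add_mem (add_mem (add_mem h1 h2) h3) h4) h5) h6) h7

/-- COROLLARY (soundness of the moves + the tree's `ζ(2) = π²/6`): **Euler's evaluation**
`Li₂(½) = ∫∫_{0<y<x<½} dxdy/((1−y)x) = π²/12 − log²2/2`. -/
theorem value_Ltri : Ltri.value = Real.pi ^ 2 / 12 - Real.log 2 ^ 2 / 2 := by
  have h0 := (AddMonoidHom.mem_ker).mp (KZ.relations_le_ker_eval_holds eulerReflection_byMoves)
  simp only [map_sub, map_nsmul, KZ.eval_mul', KZ.eval_of, value_Zsq, value_ell, nsmul_eq_mul,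
    Nat.cast_ofNat] at h0
  linarith

end Summit.KontsevichZagierPeriods.KontsevichZagierPeriods.Theorems.RootDecompQuadraticDescentEulerReflection
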